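import Summits.BirchSwinnertonDyer.BirchSwinnertonDyer.Theorems.SchneiderFreeAdditiveX3PoitouTateSelmerComplementCanonical
import Summits.BirchSwinnertonDyer.Rank1Residual.X11b.WeilTransport
import Literature.NumberTheory.GaloisRepresentations.ContinuousCupProductCompat
import Literature.NumberTheory.GaloisRepresentations.ArchimedeanLocalDuality
import HarnessLib

/-!
# Poitou–Tate toolkit (4/4): the dual middle exactness is the middle exactness for `M^D`
# (biduality `M ≅ M^{DD}` and graded commutativity of the cup product) — so `SelmerComplement`
# ⟸ Milne I Thm. 4.10(b) `Ker γ¹ ⊆ Im β¹` ALONE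

Seat `bsd-schneider-door-c6`, gen 5 (cell `bsd-schneider-ideate`; crux `AnticycControlAdditiveK`,
stmt-BirchSwinnertonDyer-19295).  THEOREMS ONLY (no definition, no named fact, no `sorry`).  HONEST
FRAMING: proves NO case of Poitou–Tate duality and no case of BSD.  Files 1–3
(`…PoitouTateLocalDualityEveryPlace`, `…PoitouTateSelmerComplementReduction`,
`…PoitouTateSelmerComplementCanonical`) reduced the conjunct `SelmerComplement` (Howard 2004
Thm. 2.1.11) of the named fact `poitouTate_selmerStructure_duality` — its one unproved conjunct at
prime-power level, on which the registered stubs `stub_baseCountTors` / `stub_ptSurj` / `stub_coinv` of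
crux 19295 hinge — to TWO basic middle-exactness statements: `hE` (Milne I Thm. 4.10(b) for `M`) and its
dual form `hE'` (the same for `M^D`, with `M` on the left of the pairing).  This file removes `hE'`:

* §1 `exists_bidual_intertwining` — **biduality `M ⥲ M^{DD}`**, `m ↦ (f ↦ f m)`, as a pair of inverse
  continuous `Γ_K`-intertwining maps (finite `M` killed by `n`; characters into `μₙ ≅ ℤ/n` separate
  points, `#Hom(M, μₙ) = #M`; Milne I Prop. 0.19);
* §2 `localTatePairing_tateDual_map_bidual` — **`u ∪' H¹(ι_v) x = -(x ∪ u)`** in `H²(K_v, μₙ)`: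
  naturality of the cup product in the coefficient pairing (`ContPairing.cupProduct_map`) and graded
  commutativity in bidegree `(1,1)` (`ContPairing.cupProduct_comm`, NSW (1.4.4)); `…ZMod…` through any
  additive `inv_v`; `isUnramifiedAt_tateDual` (`M^D` is unramified at `v ∤ n` where `M` is);
* §3 **`middleExact_dual_of_middleExact`** — `hE` for all finite `n`-torsion modules ⟹ `hE'` for all
  of them (apply `hE` to `M^D`; every class of `H¹(K, M^{DD})` unramified outside `S` is the transport of
  one of `H¹(K, M)` unramified outside `S`; the sign is immaterial for vanishing);
  **`selmerComplement_of_middleExact'`** — `IsPerfect`, `InjectiveAtRealPlaces`, `UnramifiedOrthogonal`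
  and `hE` ALONE ⟹ `SelmerComplement`;
* §4 for THE invariant maps of `K : Type` at a prime-power level:
  **`selmerComplement_canonical_of_middleExact'`** and
  **`exists_localInvariants_duality_of_middleExact_canonical`** — the four-property family that every
  consumer of `poitouTate_selmerStructure_duality` destructures ⟸ Milne I Thm. 4.10(b) `Ker γ¹ ⊆ Im β¹`
  for `LocalInvariants.canonical K n`, for all finite `n`-torsion `M` and all finite
  `S ⊇ {v ∣ ∞} ∪ {v ∣ n} ∪ Ram(M)` — ONE printed statement, nothing else.

References: [MilneADT2006] I Prop. 0.19, Cor. 2.3, Thm. 2.6, Thm. 4.10 (b); [NeukirchSchmidtWingberg2008]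
I §4 (1.4.4); [Howard2004HeegnerKolyvagin] Thm. 2.1.11 (arXiv:1202.6340 p. 6).
-/

noncomputable section

open Function NumberField IsDedekindDomain CategoryTheory
open scoped NumberField ContRepresentation

universe u

set_option linter.dupNamespace false

namespace Summit.BirchSwinnertonDyer.BirchSwinnertonDyer.Theorems.SchneiderFreeAdditiveX3.PoitouTateReduction

open Field
open Literature.NumberTheory.GaloisRepresentations Literature.NumberTheory.GaloisCohomology
open Literature.NumberTheory.GaloisRepresentations.DiscreteGaloisModule (mu MuCarrier TateDual tateDual
  tateDualEval tateDualPairingLocal localTatePairing localTatePairingZMod unramifiedSubgroup SelmerStructure)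
open Summit.BirchSwinnertonDyer.Rank1Residual.X11b

/-! ## §1. Biduality `M ≅ M^{DD}` as a pair of inverse intertwining maps -/

section Bidual

variable {K : Type u} [Field K] [CharZero K] {n : ℕ} [NeZero n]
variable {M : Type u} [AddCommGroup M] [TopologicalSpace M] [DiscreteTopology M] [Finite M]

/-- **Biduality `M ⥲ M^{DD} = Hom(Hom(M, μₙ), μₙ)`, `m ↦ (f ↦ f m)`, as a pair of inverse continuous
`Γ_K`-intertwining maps** of discrete Galois modules, for a finite `M` killed by `n` (characters into
`μₙ ≅ ℤ/n` separate points, `#Hom(M, μₙ) = #M`; Milne *ADT* I Prop. 0.19 / §2 "`M^{DD} = M`").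
[cite: MilneADT2006, Ch. I §0, Prop. 0.19] -/
theorem exists_bidual_intertwining [Finite (TateDual K M n)] (ρ : DiscreteGaloisModule K M)
    (hM : ∀ m : M, n • m = 0) :
    ∃ (ι : ρ.toContRepresentation →ⁱL ((ρ.tateDual n).tateDual n).toContRepresentation)
      (κ : ((ρ.tateDual n).tateDual n).toContRepresentation →ⁱL ρ.toContRepresentation),
      (∀ (m : M) (f : TateDual K M n), ι m f = f m) ∧ (∀ m : M, κ (ι m) = m) ∧
        ∀ φ : TateDual K (TateDual K M n) n, ι (κ φ) = φ := by
  -- the evaluation map and its equivariance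
  let ev : M →+ TateDual K (TateDual K M n) n := tateDualEval K M n
  have hev : ∀ (m : M) (f : TateDual K M n), ev m f = f m := fun m f => rfl
  have hsmul : ∀ (σ : absoluteGaloisGroup K) (m : M),
      ev (ρ σ m) = (ρ.tateDual n).tateDual n σ (ev m) := fun σ m => by
    refine DiscreteGaloisModule.TateDual.ext fun f => ?_
    rw [hev, DiscreteGaloisModule.tateDual_apply_apply_apply, hev,
      DiscreteGaloisModule.tateDual_apply_apply_apply, inv_inv, ← Module.End.mul_apply, ← map_mul,
      mul_inv_cancel, map_one, Module.End.one_apply]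
  -- bijectivity: injective (characters separate points) and `#M^{DD} = #M^D = #M`
  have hinj : Injective ev := tateDualEval_injective n hM
  have hD : ∀ f : TateDual K M n, n • f = 0 := fun f => DiscreteGaloisModule.TateDual.nsmul_eq_zero f
  have hc1 : Nat.card (TateDual K M n) = Nat.card M := HomCarrier.natCard_eq (muEquivZMod K n) hM
  have hc2 : Nat.card (TateDual K (TateDual K M n) n) = Nat.card (TateDual K M n) :=
    HomCarrier.natCard_eq (muEquivZMod K n) hD
  haveI : Finite (TateDual K (TateDual K M n) n) := DiscreteGaloisModule.TateDual.finite K (TateDual K M n) n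
  have hbij : Bijective ev := hinj.bijective_of_nat_card_le (by rw [hc2, hc1])
  let e : M ≃+ TateDual K (TateDual K M n) n := AddEquiv.ofBijective ev hbij
  refine ⟨{ toContinuousLinearMap := ⟨ev.toIntLinearMap, continuous_of_discreteTopology⟩
            isIntertwining' := fun σ => ContinuousLinearMap.ext fun m => hsmul σ m },
          { toContinuousLinearMap := ⟨e.symm.toAddMonoidHom.toIntLinearMap, continuous_of_discreteTopology⟩
            isIntertwining' := fun σ => ContinuousLinearMap.ext fun φ => ?_ },
          fun m f => rfl, fun m => e.symm_apply_apply m, fun φ => e.apply_symm_apply φ⟩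
  change e.symm (((ρ.tateDual n).tateDual n).toContRepresentation σ φ) =
    ρ.toContRepresentation σ (e.symm φ)
  apply e.injective
  rw [AddEquiv.apply_symm_apply, ContinuousRep.toContRepresentation_apply_apply,
    ContinuousRep.toContRepresentation_apply_apply, AddEquiv.ofBijective_apply, hsmul,
    ← AddEquiv.ofBijective_apply ev hbij, AddEquiv.apply_symm_apply]

end Bidual

/-! ## §2. The local Tate pairing through biduality: `⟨u, ι x⟩' = -⟨x, u⟩` -/

section LocalSign

variable {K : Type u} [Field K] [NumberField K] {n : ℕ} [NeZero n]
variable {M : Type u} [AddCommGroup M] [TopologicalSpace M] [DiscreteTopology M] [Finite M]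

omit [NeZero n] in
/-- **`u ∪' H¹(ι_v) x = -(x ∪ u)` in `H²(K_v, μₙ)`** for local classes `x ∈ H¹(K_v, M)`,
`u ∈ H¹(K_v, M^D)`: the local Tate pairing of `M^D` (cup product for `M^D × M^{DD} → μₙ`) evaluated on the
biduality transport of `x` is minus the local Tate pairing of `M` — naturality of the cup product in the
coefficient pairing (`ContPairing.cupProduct_map`, `⟨f, ι m⟩' = f m = ⟨m, f⟩`) and graded commutativity in
bidegree `(1, 1)` (`ContPairing.cupProduct_comm`, NSW (1.4.4)).
[cite: NeukirchSchmidtWingberg2008, I §4 (1.4.4)] [cite: MilneADT2006, Ch. I, Cor. 2.3] -/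
theorem localTatePairing_tateDual_map_bidual [Finite (TateDual K M n)] (ρ : DiscreteGaloisModule K M)
    (ι : ρ.toContRepresentation →ⁱL ((ρ.tateDual n).tateDual n).toContRepresentation)
    (hι : ∀ (m : M) (f : TateDual K M n), ι m f = f m) (v : Place K)
    (x : galoisCohomology (ρ.toLocal v) 1) (u : galoisCohomology ((ρ.tateDual n).toLocal v) 1) :
    localTatePairing (ρ.tateDual n) n v u
        (galoisCohomology.map (ι.restrictField (Place.Completion v)) 1 x) =
      -localTatePairing ρ n v x u := by
  haveI := absoluteGaloisGroup_compactSpace (Place.Completion (K := K) v)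
  have h := ContPairing.cupProduct_map (tateDualPairingLocal ρ n v).flip
    (tateDualPairingLocal (ρ.tateDual n) n v) (𝟙 _)
    (DiscreteGaloisModule.homOfIntertwining (ι.restrictField (Place.Completion v))) (𝟙 _)
    (fun f m => (hι m f).symm) u x
  have h1 : cohomologyMap (𝟙 ((ρ.tateDual n).toLocal v).toTopRep) 1 u = u := by
    rw [show cohomologyMap (𝟙 ((ρ.tateDual n).toLocal v).toTopRep) 1 = 𝟙 _ from
      map_id_eq_id _ (fun _ => rfl) 1]
    rfl
  have h2 : cohomologyMap (𝟙 ((mu K n).toLocal v).toTopRep) 2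
      ((tateDualPairingLocal ρ n v).flip.cupProduct u x) =
        (tateDualPairingLocal ρ n v).flip.cupProduct u x := by
    rw [show cohomologyMap (𝟙 ((mu K n).toLocal v).toTopRep) 2 = 𝟙 _ from
      map_id_eq_id _ (fun _ => rfl) 2]
    rfl
  rw [h1, h2, DiscreteGaloisModule.cohomologyMap_homOfIntertwining] at h
  have h3 : (tateDualPairingLocal ρ n v).flip.cupProduct u x =
      -(tateDualPairingLocal ρ n v).cupProduct x u := by
    rw [(tateDualPairingLocal ρ n v).cupProduct_comm x u, neg_neg]
  exact h.symm.trans h3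

omit [NeZero n] in
/-- The same through an additive `inv_v : H²(K_v, μₙ) → ℤ/n`:
`inv_v(u ∪' H¹(ι_v) x) = -inv_v(x ∪ u)`. [cite: NeukirchSchmidtWingberg2008, I §4 (1.4.4)] -/
theorem localTatePairingZMod_tateDual_map_bidual [Finite (TateDual K M n)] (ρ : DiscreteGaloisModule K M)
    (ι : ρ.toContRepresentation →ⁱL ((ρ.tateDual n).tateDual n).toContRepresentation)
    (hι : ∀ (m : M) (f : TateDual K M n), ι m f = f m) (v : Place K)
    (inv : galoisCohomology ((mu K n).toLocal v) 2 →+ ZMod n)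
    (x : galoisCohomology (ρ.toLocal v) 1) (u : galoisCohomology ((ρ.tateDual n).toLocal v) 1) :
    localTatePairingZMod (ρ.tateDual n) n v inv u
        (galoisCohomology.map (ι.restrictField (Place.Completion v)) 1 x) =
      -localTatePairingZMod ρ n v inv x u := by
  rw [DiscreteGaloisModule.localTatePairingZMod_apply, DiscreteGaloisModule.localTatePairingZMod_apply,
    localTatePairing_tateDual_map_bidual ρ ι hι v x u, map_neg]

omit [NeZero n] in
/-- **`M^D` is unramified at `v ∤ n` where `M` is** (`GaloisRep.IsUnramifiedAt` form of n1011's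
`UnramifiedCup.toLocal_tateDual_apply_of_mem_absInertia_of_not_mem`). [cite: MilneADT2006, Ch. I §2, before Thm. 2.6] -/
theorem isUnramifiedAt_tateDual (ρ : DiscreteGaloisModule K M) (v : HeightOneSpectrum (𝓞 K))
    (hv : ((n : ℕ) : 𝓞 K) ∉ v.asIdeal) (hur : GaloisRep.IsUnramifiedAt v ρ) :
    GaloisRep.IsUnramifiedAt v (ρ.tateDual n) := by
  rw [GaloisRep.isUnramifiedAt_iff_toLocal_holds]
  intro σ hσ
  refine DFunLike.ext _ _ fun f => ?_
  rw [Rank1Residual.GaloisImage.UnramifiedCup.toLocal_tateDual_apply_of_mem_absInertia_of_not_mem ρ n v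
    hv hur hσ f]
  rfl

end LocalSign

/-! ## §3. The dual middle exactness for `M` from the middle exactness for `M^D` -/

section Transport

variable {K : Type u} [Field K] [NumberField K] {n : ℕ} [NeZero n]

/-- **Milne I Thm. 4.10(b) for `M^D`, read through `M^{DD} = M`, is the dual middle exactness for
`M`.**  If for EVERY finite `n`-torsion module the basic middle exactness holds for the family `inv`
(hypothesis `hE`, the shape consumed by `selmerComplement_of_middleExact`), then so does its dual form
`hE'` (`M` on the left of the pairing): given `u ∈ ⊕_{v∈S} H¹(K_v, M^D)` with
`∑_{v∈S} ⟨x_v, u_v⟩_v = 0` for all `x ∈ H¹(K, M)` unramified outside `S`, apply `hE` to `M^D` and `t = u`: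
every `z ∈ H¹(K, M^{DD})` unramified outside `S` is `H¹(ι) x` with `x = H¹(ι⁻¹) z` unramified outside
`S`, and `⟨u_v, (H¹(ι) x)_v⟩'_v = -⟨x_v, u_v⟩_v` (`localTatePairingZMod_tateDual_map_bidual`).
[cite: MilneADT2006, Ch. I, Thm. 4.10(b)] [cite: Howard2004HeegnerKolyvagin, Thm. 2.1.11 (arXiv:1202.6340 p. 6)] -/
theorem middleExact_dual_of_middleExact (inv : LocalInvariants K n)
    (hE : ∀ ⦃M : Type u⦄ [AddCommGroup M] [TopologicalSpace M] [DiscreteTopology M] [Finite M]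
      (ρ : DiscreteGaloisModule K M), (∀ m : M, n • m = 0) →
      ∀ S : Finset (Place K), (∀ w : InfinitePlace K, (Sum.inl w : Place K) ∈ S) →
        (∀ v : HeightOneSpectrum (𝓞 K), (Sum.inr v : Place K) ∉ S →
          ((n : ℕ) : 𝓞 K) ∉ v.asIdeal ∧ GaloisRep.IsUnramifiedAt v ρ) →
        ∀ t : Π v : Place K, galoisCohomology (ρ.toLocal v) 1,
          (∀ y : galoisCohomology (ρ.tateDual n) 1,
            (∀ v : HeightOneSpectrum (𝓞 K), (Sum.inr v : Place K) ∉ S →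
              galoisCohomology.localization (ρ.tateDual n) (Sum.inr v) 1 y ∈
                unramifiedSubgroup (GaloisRep.toLocal v (ρ.tateDual n)) 1) →
            ∑ v ∈ S, localTatePairingZMod ρ n v (inv v) (t v)
              (galoisCohomology.localization (ρ.tateDual n) v 1 y) = 0) →
          ∃ x : galoisCohomology ρ 1,
            (∀ v : HeightOneSpectrum (𝓞 K), (Sum.inr v : Place K) ∉ S →
              galoisCohomology.localization ρ (Sum.inr v) 1 x ∈
                unramifiedSubgroup (GaloisRep.toLocal v ρ) 1) ∧
            ∀ v ∈ S, galoisCohomology.localization ρ v 1 x = t v)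
    ⦃M : Type u⦄ [AddCommGroup M] [TopologicalSpace M] [DiscreteTopology M] [Finite M]
    (ρ : DiscreteGaloisModule K M) (hM : ∀ m : M, n • m = 0)
    (S : Finset (Place K)) (hinf : ∀ w : InfinitePlace K, (Sum.inl w : Place K) ∈ S)
    (hS : ∀ v : HeightOneSpectrum (𝓞 K), (Sum.inr v : Place K) ∉ S →
      ((n : ℕ) : 𝓞 K) ∉ v.asIdeal ∧ GaloisRep.IsUnramifiedAt v ρ)
    (u : Π v : Place K, galoisCohomology ((ρ.tateDual n).toLocal v) 1)
    (horth : ∀ x : galoisCohomology ρ 1,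
      (∀ v : HeightOneSpectrum (𝓞 K), (Sum.inr v : Place K) ∉ S →
        galoisCohomology.localization ρ (Sum.inr v) 1 x ∈ unramifiedSubgroup (GaloisRep.toLocal v ρ) 1) →
      ∑ v ∈ S, localTatePairingZMod ρ n v (inv v) (galoisCohomology.localization ρ v 1 x) (u v) = 0) :
    ∃ y : galoisCohomology (ρ.tateDual n) 1,
      (∀ v : HeightOneSpectrum (𝓞 K), (Sum.inr v : Place K) ∉ S →
        galoisCohomology.localization (ρ.tateDual n) (Sum.inr v) 1 y ∈
          unramifiedSubgroup (GaloisRep.toLocal v (ρ.tateDual n)) 1) ∧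
      ∀ v ∈ S, galoisCohomology.localization (ρ.tateDual n) v 1 y = u v := by
  haveI := DiscreteGaloisModule.TateDual.finite K M n
  haveI := DiscreteGaloisModule.TateDual.finite K (TateDual K M n) n
  obtain ⟨ι, κ, hι, hκι, hικ⟩ := exists_bidual_intertwining (n := n) ρ hM
  refine hE (ρ.tateDual n) (fun f => DiscreteGaloisModule.TateDual.nsmul_eq_zero f) S hinf
    (fun v hv => ⟨(hS v hv).1, isUnramifiedAt_tateDual ρ v (hS v hv).1 (hS v hv).2⟩) u fun z hz => ?_
  -- `z = H¹(ι) x` with `x = H¹(κ) z` unramified outside `S`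
  set x : galoisCohomology ρ 1 := galoisCohomology.map κ 1 z with hx_def
  have hzx : galoisCohomology.map ι 1 x = z := Levels.map_map_eq_self_of_comp_eq κ ι hικ z
  have hx : ∀ v : HeightOneSpectrum (𝓞 K), (Sum.inr v : Place K) ∉ S →
      galoisCohomology.localization ρ (Sum.inr v) 1 x ∈ unramifiedSubgroup (GaloisRep.toLocal v ρ) 1 :=
    fun v hv => by
      rw [hx_def, show galoisCohomology.localization ρ (Sum.inr v) 1 (galoisCohomology.map κ 1 z) =
        galoisCohomology.map (κ.restrictField (Place.Completion (Sum.inr v))) 1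
          (galoisCohomology.localization ((ρ.tateDual n).tateDual n) (Sum.inr v) 1 z) from
        galoisCohomology.res_map_one _ κ z]
      exact Levels.map_mem_unramifiedSubgroup _ (hz v hv)
  have h0 := horth x hx
  rw [← hzx]
  have hterm : ∀ v ∈ S, localTatePairingZMod (ρ.tateDual n) n v (inv v) (u v)
      (galoisCohomology.localization ((ρ.tateDual n).tateDual n) v 1 (galoisCohomology.map ι 1 x)) =
        -localTatePairingZMod ρ n v (inv v) (galoisCohomology.localization ρ v 1 x) (u v) := fun v _ => by
    rw [show galoisCohomology.localization ((ρ.tateDual n).tateDual n) v 1 (galoisCohomology.map ι 1 x) =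
        galoisCohomology.map (ι.restrictField (Place.Completion v)) 1 (galoisCohomology.localization ρ v 1 x)
      from galoisCohomology.res_map_one _ ι x]
    exact localTatePairingZMod_tateDual_map_bidual ρ ι hι v (inv v) _ _
  rw [Finset.sum_congr rfl hterm, Finset.sum_neg_distrib, h0, neg_zero]

/-- **`SelmerComplement` (Howard Thm. 2.1.11, both inclusions, all pairs `𝓕 ≤ 𝓖`) from Milne I
Thm. 4.10(b) `Ker γ¹ ⊆ Im β¹` ALONE** — for a family `inv` with `IsPerfect`, `InjectiveAtRealPlaces` and
`UnramifiedOrthogonal`: the dual hypothesis `hE'` of `selmerComplement_of_middleExact` is `hE` for `M^D`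
(`middleExact_dual_of_middleExact`).
[cite: MilneADT2006, Ch. I, Thm. 4.10(b)] [cite: Howard2004HeegnerKolyvagin, Thm. 2.1.11 (arXiv:1202.6340 p. 6)] -/
theorem selmerComplement_of_middleExact' (inv : LocalInvariants K n) (hperf : inv.IsPerfect)
    (hreal : inv.InjectiveAtRealPlaces) (hUO : inv.UnramifiedOrthogonal)
    (hE : ∀ ⦃M : Type u⦄ [AddCommGroup M] [TopologicalSpace M] [DiscreteTopology M] [Finite M]
      (ρ : DiscreteGaloisModule K M), (∀ m : M, n • m = 0) →
      ∀ S : Finset (Place K), (∀ w : InfinitePlace K, (Sum.inl w : Place K) ∈ S) →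
        (∀ v : HeightOneSpectrum (𝓞 K), (Sum.inr v : Place K) ∉ S →
          ((n : ℕ) : 𝓞 K) ∉ v.asIdeal ∧ GaloisRep.IsUnramifiedAt v ρ) →
        ∀ t : Π v : Place K, galoisCohomology (ρ.toLocal v) 1,
          (∀ y : galoisCohomology (ρ.tateDual n) 1,
            (∀ v : HeightOneSpectrum (𝓞 K), (Sum.inr v : Place K) ∉ S →
              galoisCohomology.localization (ρ.tateDual n) (Sum.inr v) 1 y ∈
                unramifiedSubgroup (GaloisRep.toLocal v (ρ.tateDual n)) 1) →
            ∑ v ∈ S, localTatePairingZMod ρ n v (inv v) (t v)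
              (galoisCohomology.localization (ρ.tateDual n) v 1 y) = 0) →
          ∃ x : galoisCohomology ρ 1,
            (∀ v : HeightOneSpectrum (𝓞 K), (Sum.inr v : Place K) ∉ S →
              galoisCohomology.localization ρ (Sum.inr v) 1 x ∈
                unramifiedSubgroup (GaloisRep.toLocal v ρ) 1) ∧
            ∀ v ∈ S, galoisCohomology.localization ρ v 1 x = t v) :
    inv.SelmerComplement :=
  selmerComplement_of_middleExact inv hperf hreal hUO hE
    fun _ _ _ _ _ ρ hM S hinf hS u horth => middleExact_dual_of_middleExact inv hE ρ hM S hinf hS u horth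

end Transport

/-! ## §4. THE invariant maps at a prime-power level -/

section Canonical

variable {K : Type} [Field K] [NumberField K]

/-- **At a prime-power level, `SelmerComplement` of the canonical family ⟸ Milne I Thm. 4.10(b)
`Ker γ¹ ⊆ Im β¹` for THE invariant maps, nothing else.** [cite: MilneADT2006, Ch. I, Thm. 4.10(b)]
[cite: Howard2004HeegnerKolyvagin, Thm. 2.1.11 (arXiv:1202.6340 p. 6)] -/
theorem selmerComplement_canonical_of_middleExact' (n : ℕ) [NeZero n] (hn : IsPrimePow n)
    (hE : ∀ ⦃M : Type⦄ [AddCommGroup M] [TopologicalSpace M] [DiscreteTopology M] [Finite M]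
      (ρ : DiscreteGaloisModule K M), (∀ m : M, n • m = 0) →
      ∀ S : Finset (Place K), (∀ w : InfinitePlace K, (Sum.inl w : Place K) ∈ S) →
        (∀ v : HeightOneSpectrum (𝓞 K), (Sum.inr v : Place K) ∉ S →
          ((n : ℕ) : 𝓞 K) ∉ v.asIdeal ∧ GaloisRep.IsUnramifiedAt v ρ) →
        ∀ t : Π v : Place K, galoisCohomology (ρ.toLocal v) 1,
          (∀ y : galoisCohomology (ρ.tateDual n) 1,
            (∀ v : HeightOneSpectrum (𝓞 K), (Sum.inr v : Place K) ∉ S →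
              galoisCohomology.localization (ρ.tateDual n) (Sum.inr v) 1 y ∈
                unramifiedSubgroup (GaloisRep.toLocal v (ρ.tateDual n)) 1) →
            ∑ v ∈ S, localTatePairingZMod ρ n v (LocalInvariants.canonical K n v) (t v)
              (galoisCohomology.localization (ρ.tateDual n) v 1 y) = 0) →
          ∃ x : galoisCohomology ρ 1,
            (∀ v : HeightOneSpectrum (𝓞 K), (Sum.inr v : Place K) ∉ S →
              galoisCohomology.localization ρ (Sum.inr v) 1 x ∈
                unramifiedSubgroup (GaloisRep.toLocal v ρ) 1) ∧
            ∀ v ∈ S, galoisCohomology.localization ρ v 1 x = t v) :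
    (LocalInvariants.canonical K n).SelmerComplement :=
  selmerComplement_of_middleExact' _ LocalInvariants.canonical_isPerfect
    LocalInvariants.canonical_injectiveAtRealPlaces
    (Rank1Residual.GaloisImage.UnramifiedCup.unramifiedOrthogonal_of_isPerfect _ hn
      LocalInvariants.canonical_isPerfect) hE

/-- **At a prime-power level, the four-property family of `poitouTate_selmerStructure_duality K` (what
every consumer destructures) ⟸ Milne I Thm. 4.10(b) `Ker γ¹ ⊆ Im β¹` for THE invariant maps, nothing
else** (`exists_localInvariants_duality_of_selmerComplement_canonical` ∘
`selmerComplement_canonical_of_middleExact'`). [cite: MilneADT2006, Ch. I, Thm. 4.10(b), Thm. 2.6, Cor. 2.3]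
[cite: Howard2004HeegnerKolyvagin, Thm. 2.1.11 (arXiv:1202.6340 p. 6)] -/
theorem exists_localInvariants_duality_of_middleExact_canonical (n : ℕ) [NeZero n] (hn : IsPrimePow n)
    (hE : ∀ ⦃M : Type⦄ [AddCommGroup M] [TopologicalSpace M] [DiscreteTopology M] [Finite M]
      (ρ : DiscreteGaloisModule K M), (∀ m : M, n • m = 0) →
      ∀ S : Finset (Place K), (∀ w : InfinitePlace K, (Sum.inl w : Place K) ∈ S) →
        (∀ v : HeightOneSpectrum (𝓞 K), (Sum.inr v : Place K) ∉ S →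
          ((n : ℕ) : 𝓞 K) ∉ v.asIdeal ∧ GaloisRep.IsUnramifiedAt v ρ) →
        ∀ t : Π v : Place K, galoisCohomology (ρ.toLocal v) 1,
          (∀ y : galoisCohomology (ρ.tateDual n) 1,
            (∀ v : HeightOneSpectrum (𝓞 K), (Sum.inr v : Place K) ∉ S →
              galoisCohomology.localization (ρ.tateDual n) (Sum.inr v) 1 y ∈
                unramifiedSubgroup (GaloisRep.toLocal v (ρ.tateDual n)) 1) →
            ∑ v ∈ S, localTatePairingZMod ρ n v (LocalInvariants.canonical K n v) (t v)
              (galoisCohomology.localization (ρ.tateDual n) v 1 y) = 0) →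
          ∃ x : galoisCohomology ρ 1,
            (∀ v : HeightOneSpectrum (𝓞 K), (Sum.inr v : Place K) ∉ S →
              galoisCohomology.localization ρ (Sum.inr v) 1 x ∈
                unramifiedSubgroup (GaloisRep.toLocal v ρ) 1) ∧
            ∀ v ∈ S, galoisCohomology.localization ρ v 1 x = t v) :
    ∃ inv : LocalInvariants K n,
      inv.IsPerfect ∧ inv.SumLocalTermEqZero ∧ inv.UnramifiedOrthogonal ∧ inv.SelmerComplement :=
  exists_localInvariants_duality_of_selmerComplement_canonical n hn
    (selmerComplement_canonical_of_middleExact' n hn hE)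

end Canonical

end Summit.BirchSwinnertonDyer.BirchSwinnertonDyer.Theorems.SchneiderFreeAdditiveX3.PoitouTateReduction

end
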